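import Summits.BirchSwinnertonDyer.BirchSwinnertonDyer.Theorems.ResidualThetaTransportAtTwoPlusDualLayerAlgebra
import Summits.BirchSwinnertonDyer.BirchSwinnertonDyer.Theorems.UniversalToricDescentTorsionFreeByCount
import HarnessLib

/-!
# Kim 2007 Prop. 3.15 — layer algebra toolkit: transposes of integer polynomials in `T` / `1 + T`, and MONIC DIVISORS OF
# DISTINGUISHED POLYNOMIALS over `ℤ_p` are distinguished (`ω_m/ω_n`, `ω_m + a`)

Routes `ResidualThetaTransportAtTwo` (RTT, crux r201 `ResidualLambdaFormulaNegDiscAtTwo`, stmt-BirchSwinnertonDyer-23110) /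
`ThetaPartnerAtTwo`. Seat `prover-bsd-wall-tp2-p2x-w3` g13; `--supports stmt-BirchSwinnertonDyer-23110`. THEOREMS ONLY (no definition,
no named fact, no instance, no `sorry`); PURE ALGEBRA; closes nothing. Sequel of `…PlusDualLayerAlgebra`; feeds `…PlusDualLayerNorms`
(Kim's cor-surjectivity and the twisted «invariants = norms» on the layers `S[p^J, ω_m]` of a cofree rank-one dual pair).
* §1 TRANSPOSE TOOLKIT for a dual pair `IsDualPair p ψ toDual` (`T ↦ ψ`; `ψ = φ − 1`): `toDual (n • x) s = toDual x (n • s)` (`n ∈ ℤ`),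
  `T^k ↦ ψ^k`, **integer polynomials `P(T)` act as `P(ψ)`** (`toDual_aeval_X_smul`) and **`P(1+T)` as `P(φ)`**
  (`toDual_aeval_one_add_X_smul`) — so `ω_n`, `ω̃^±_n = cyclotomicOmegaPlus/Minus`, the norms `∑ (1+T)^{pⁿi}` and the twisted norms
  `∑ cⁱ(1+T)ⁱ` all come with their transposes for the cofree calculus of `…PlusDualLayerAlgebra`.
* §2 **`isDistinguishedAt_of_mul_eq`: if `A·B = D` with `A`, `B` monic and `D` distinguished at `𝔪 = (p)`, then `A` (and `B`) is
  distinguished** — modulo `𝔪`, `Ā·B̄ = T^{deg D}` in `𝔽_p[T]` and trailing degrees add, forcing `Ā = T^{deg A}`. Corollaries: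
  `ω_m = ω_n · ν_{m/n}` with `ν_{m/n} = ∑_{i<p^{m−n}} (1+T)^{pⁿi}` distinguished of degree `p^m − pⁿ`
  (`isDistinguishedAt_geom_sum`), `D + C a` distinguished for `a ∈ 𝔪` (`isDistinguishedAt_add_C`), `c ≡ 1 (p)` is a unit of `ℤ_p`.

HONEST FRAMING: closes nothing; 23110 is NOT proved; BSD is not proved by any of this.
References: [BDKim2007] Prop. 3.15 (proof, pp. 56–57); [Washington1997] §7.1 (distinguished polynomials), Thm. 7.1, §13.2;
[Lang1990] Ch. 5 §1; [GreenbergLNM1716] §1 p. 60.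
-/

set_option autoImplicit false
-- D-0017: single-problem summit, so `Summit.BirchSwinnertonDyer.BirchSwinnertonDyer.…` repeats a namespace BY DESIGN.
set_option linter.dupNamespace false

noncomputable section

open scoped Classical
open Polynomial Literature.NumberTheory.EllipticCurves Literature.NumberTheory.EllipticCurves.IwasawaDual

namespace Summit.BirchSwinnertonDyer.BirchSwinnertonDyer.Theorems.ResidualThetaLayer.PlusDual

/-! ## §1 The transpose toolkit -/

section Transpose

variable {p : ℕ} [Fact p.Prime]
variable {S : Type*} [AddCommGroup S] {φ ψ : AddMonoid.End S}
variable {X : Type*} [AddCommGroup X] [Module (PowerSeries ℤ_[p]) X]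
variable {toDual : X →+ (S →+ AddCircle (1 : ℚ))}

omit [Fact p.Prime] in
/-- `toDual (n • x) s = toDual x (n • s)` for `n ∈ ℤ` (additivity). [folklore] -/
theorem zsmul_eval (n : ℤ) (x : X) (s : S) : toDual (n • x) s = toDual x (n • s) := by
  cases n with
  | ofNat m => rw [Int.ofNat_eq_natCast, natCast_zsmul, natCast_zsmul, nsmul_eval]
  | negSucc m =>
    rw [negSucc_zsmul, negSucc_zsmul, map_neg, AddMonoidHom.neg_apply, nsmul_eval, map_neg]

/-- Integer constants of `Λ` act through `toDual` as integer multiples: `toDual ((n : Λ) • x) s = toDual x (n • s)`. [folklore] -/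
theorem toDual_intCast_smul (n : ℤ) (x : X) (s : S) :
    toDual ((n : PowerSeries ℤ_[p]) • x) s = toDual x (n • s) := by
  rw [Int.cast_smul_eq_zsmul, zsmul_eval]

/-- `T^k` acts as `ψ^k`: `toDual (T^k • x) s = toDual x (ψ^k s)`. [cite: GreenbergLNM1716, §1 p. 60 (`T = γ − 1`)] -/
theorem toDual_X_pow_smul (h : IsDualPair p ψ toDual) (k : ℕ) (x : X) (s : S) :
    toDual (((PowerSeries.X : PowerSeries ℤ_[p]) ^ k) • x) s = toDual x ((ψ ^ k) s) := by
  induction k generalizing x with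
  | zero => rw [pow_zero, one_smul, pow_zero, AddMonoid.End.one_apply]
  | succ k ih => rw [pow_succ, mul_smul, ih, h.T_smul, pow_succ']; rfl

/-- **Integer polynomials in `T` act as the same polynomials in `ψ`.** For a dual pair with `T ↦ ψ` and `P ∈ ℤ[T]`:
`toDual (P(T) • x) s = toDual x (P(ψ) s)`; with `P = ω̃^±_n`, `T·ω̃^±_n` (`cyclotomicOmegaPlus/Minus`) these are Kim's `ω`-operators.
[cite: GreenbergLNM1716, §1 p. 60 (`T = γ − 1`)] [cite: BDKim2007, Prop. 3.15 (proof)] -/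
theorem toDual_aeval_X_smul (h : IsDualPair p ψ toDual) (P : Polynomial ℤ) (x : X) (s : S) :
    toDual ((Polynomial.aeval (PowerSeries.X : PowerSeries ℤ_[p]) P) • x) s = toDual x (Polynomial.aeval ψ P s) := by
  induction P using Polynomial.induction_on' generalizing x with
  | add P Q hP hQ =>
    rw [map_add, add_smul, map_add, AddMonoidHom.add_apply, hP, hQ, ← map_add, map_add (Polynomial.aeval ψ) P Q]
    rfl
  | monomial n a =>
    rw [Polynomial.aeval_monomial, Polynomial.aeval_monomial, mul_smul, eq_intCast, toDual_intCast_smul,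
      toDual_X_pow_smul h, eq_intCast, map_zsmul]
    congr 1

/-- **Integer polynomials in `1 + T` act as the same polynomials in `φ`.** For a dual pair with `T ↦ φ − 1` and `P ∈ ℤ[Y]`:
`toDual (P(1+T) • x) s = toDual x (P(φ) s)`. With `P = Y^{pⁿ} − 1` this is `ω_n ↦ φ^{pⁿ} − 1` (`IsDualPair.toDual_one_add_X_pow_smul`),
with `P = ∑ Y^{p^m i}` the norms `ω_{m'}/ω_m`, with `P = ∑ cⁱYⁱ` the twisted norms.
[cite: GreenbergLNM1716, §1 p. 60 (`T = γ − 1`)] [cite: BDKim2007, Prop. 3.15 (proof)] -/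
theorem toDual_aeval_one_add_X_smul (h : IsDualPair p (φ - 1) toDual) (P : Polynomial ℤ) (x : X) (s : S) :
    toDual ((Polynomial.aeval (1 + PowerSeries.X : PowerSeries ℤ_[p]) P) • x) s = toDual x (Polynomial.aeval φ P s) := by
  induction P using Polynomial.induction_on' generalizing x with
  | add P Q hP hQ =>
    rw [map_add, add_smul, map_add, AddMonoidHom.add_apply, hP, hQ, ← map_add, map_add (Polynomial.aeval φ) P Q]
    rfl
  | monomial n a =>
    rw [Polynomial.aeval_monomial, Polynomial.aeval_monomial, mul_smul, eq_intCast, toDual_intCast_smul,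
      h.toDual_one_add_X_pow_smul, eq_intCast, map_zsmul]
    congr 1

end Transpose

/-! ## §2 Monic divisors of distinguished polynomials are distinguished -/

section Distinguished

variable {p : ℕ} [Fact p.Prime]

/-- **A monic divisor of a distinguished polynomial over `ℤ_p` is distinguished.** If `A·B = D` with `A`, `B` monic and `D`
distinguished at `𝔪 = (p)`, then `A` is distinguished: modulo `𝔪` one has `Ā·B̄ = T^{deg D}` in `𝔽_p[T]`, so the trailing degrees
add up to `deg A + deg B`, forcing `Ā = T^{deg A}`, i.e. all lower coefficients of `A` lie in `𝔪`. (Used for `ω_m/ω_n = ∏ Φ_{p^k}(1+T)`,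
`ω̃^±_n`, `T ω̃^±_n`, and the twisted norm polynomials — all monic divisors of some `ω_m`.)
[cite: Washington1997, §7.1 (distinguished polynomials)] [cite: Lang1990, Ch. 5 §1] -/
theorem isDistinguishedAt_of_mul_eq {A B D : ℤ_[p][X]} (hD : D.IsDistinguishedAt (IsLocalRing.maximalIdeal ℤ_[p]))
    (hA : A.Monic) (hB : B.Monic) (hAB : A * B = D) :
    A.IsDistinguishedAt (IsLocalRing.maximalIdeal ℤ_[p]) := by
  set 𝔪 := IsLocalRing.maximalIdeal ℤ_[p] with h𝔪
  set Abar := A.map (Ideal.Quotient.mk 𝔪) with hAbar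
  set Bbar := B.map (Ideal.Quotient.mk 𝔪) with hBbar
  have hprod : Abar * Bbar = Polynomial.X ^ D.natDegree := by
    rw [hAbar, hBbar, ← Polynomial.map_mul, hAB, hD.map_eq_X_pow]
  have hA0 : Abar ≠ 0 := (hA.map _).ne_zero
  have hB0 : Bbar ≠ 0 := (hB.map _).ne_zero
  have htrail : Abar.natTrailingDegree + Bbar.natTrailingDegree = A.natDegree + B.natDegree := by
    rw [← Polynomial.natTrailingDegree_mul hA0 hB0, hprod, Polynomial.natTrailingDegree_X_pow, ← hAB, hA.natDegree_mul hB]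
  have hAt : Abar.natTrailingDegree = A.natDegree := by
    have h1 : Abar.natTrailingDegree ≤ A.natDegree :=
      (Polynomial.natTrailingDegree_le_natDegree _).trans (by rw [hAbar, hA.natDegree_map])
    have h2 : Bbar.natTrailingDegree ≤ B.natDegree :=
      (Polynomial.natTrailingDegree_le_natDegree _).trans (by rw [hBbar, hB.natDegree_map])
    omega
  refine ⟨⟨fun {n} hn ↦ ?_⟩, hA⟩
  rw [← Ideal.Quotient.eq_zero_iff_mem, ← Polynomial.coeff_map, ← hAbar]
  exact Polynomial.coeff_eq_zero_of_lt_natTrailingDegree (by rw [hAt]; exact hn)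

/-- The symmetric statement: the second monic factor of a distinguished polynomial is distinguished.
[cite: Washington1997, §7.1 (distinguished polynomials)] -/
theorem isDistinguishedAt_of_mul_eq' {A B D : ℤ_[p][X]} (hD : D.IsDistinguishedAt (IsLocalRing.maximalIdeal ℤ_[p]))
    (hA : A.Monic) (hB : B.Monic) (hAB : A * B = D) :
    B.IsDistinguishedAt (IsLocalRing.maximalIdeal ℤ_[p]) :=
  isDistinguishedAt_of_mul_eq hD hB hA (by rw [mul_comm, hAB])

/-- `ω_m = (T+1)^{p^m} − 1 = ω_n · ν_{m/n}` with `ν_{m/n} = ∑_{i<p^{m−n}} (T+1)^{pⁿ i}` for `n ≤ m` (geometric sum).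
[cite: Washington1997, Thm. 7.1 and §13.2] -/
theorem omega_eq_omega_mul_geom_sum {n m : ℕ} (hnm : n ≤ m) :
    ((X + 1 : ℤ_[p][X]) ^ p ^ m - 1) =
      ((X + 1 : ℤ_[p][X]) ^ p ^ n - 1) * ∑ i ∈ Finset.range (p ^ (m - n)), ((X + 1 : ℤ_[p][X]) ^ p ^ n) ^ i := by
  rw [mul_comm, geom_sum_mul, ← pow_mul, ← pow_add, Nat.add_sub_cancel' hnm]

/-- **The norm polynomial `ν_{m/n} = ω_m/ω_n = ∑_{i<p^{m−n}} (1+T)^{pⁿi} = ∏_{n<k≤m} Φ_{p^k}(1+T)` is distinguished** of degree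
`p^m − p^n` (a monic divisor of `ω_m`). [cite: Washington1997, §7.1 and §13.2] [cite: BDKim2007, Prop. 3.15 (proof, the map `h`)] -/
theorem isDistinguishedAt_geom_sum {n m : ℕ} (hnm : n ≤ m) :
    (∑ i ∈ Finset.range (p ^ (m - n)), ((X + 1 : ℤ_[p][X]) ^ p ^ n) ^ i).IsDistinguishedAt
        (IsLocalRing.maximalIdeal ℤ_[p]) ∧
      (∑ i ∈ Finset.range (p ^ (m - n)), ((X + 1 : ℤ_[p][X]) ^ p ^ n) ^ i).natDegree = p ^ m - p ^ n := by
  have hp : p.Prime := Fact.out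
  have hωm := Kato2004.IwasawaH1Exists.isDistinguishedAt_omega p m
  have hωn := Kato2004.IwasawaH1Exists.isDistinguishedAt_omega p n
  have hfac := omega_eq_omega_mul_geom_sum (p := p) hnm
  have hνmon : (∑ i ∈ Finset.range (p ^ (m - n)), ((X + 1 : ℤ_[p][X]) ^ p ^ n) ^ i).Monic :=
    Monic.of_mul_monic_left hωn.monic (by rw [← hfac]; exact hωm.monic)
  refine ⟨isDistinguishedAt_of_mul_eq' hωm hωn.monic hνmon hfac.symm, ?_⟩
  have hdeg := congrArg Polynomial.natDegree hfac
  rw [hωn.monic.natDegree_mul hνmon, UniversalToricDescentTorsionFreeByCount.natDegree_omega p,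
    UniversalToricDescentTorsionFreeByCount.natDegree_omega p] at hdeg
  omega

/-- **Adding a constant from `𝔪` keeps a distinguished polynomial of positive degree distinguished** (e.g.
`(T+1)^{p^m} − b = ω_m + (1 − b)` for `b ≡ 1 (mod 𝔪)`, the twisted `ω_m`). [cite: Washington1997, §7.1] -/
theorem isDistinguishedAt_add_C {D : ℤ_[p][X]} (hD : D.IsDistinguishedAt (IsLocalRing.maximalIdeal ℤ_[p]))
    (hdeg : 0 < D.natDegree) {a : ℤ_[p]} (ha : a ∈ IsLocalRing.maximalIdeal ℤ_[p]) :
    (D + C a).IsDistinguishedAt (IsLocalRing.maximalIdeal ℤ_[p]) := by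
  have hlt : (C a).degree < D.degree :=
    (degree_C_le).trans_lt (by rw [degree_eq_natDegree hD.monic.ne_zero]; exact_mod_cast hdeg)
  refine ⟨⟨fun {n} hn ↦ ?_⟩, hD.monic.add_of_left hlt⟩
  rw [natDegree_add_C] at hn
  rw [coeff_add, coeff_C]
  split_ifs with h0
  · exact add_mem (hD.mem hn) ha
  · rw [add_zero]; exact hD.mem hn

/-- An integer `c ≡ 1 (mod p)` is a unit of `ℤ_p`. [folklore] -/
theorem isUnit_intCast_of_dvd_sub_one {c : ℤ} (hc : (p : ℤ) ∣ c - 1) : IsUnit (c : ℤ_[p]) := by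
  rw [PadicInt.isUnit_iff]
  by_contra hne
  have hlt : ‖(c : ℤ_[p])‖ < 1 := lt_of_le_of_ne (PadicInt.norm_le_one _) hne
  rw [PadicInt.norm_int_lt_one_iff_dvd] at hlt
  have h1 : (p : ℤ) ∣ 1 := by
    have := dvd_sub hlt hc
    simpa using this
  exact (Fact.out : p.Prime).ne_one (by exact_mod_cast Int.eq_one_of_dvd_one (by positivity) h1)

end Distinguished

end Summit.BirchSwinnertonDyer.BirchSwinnertonDyer.Theorems.ResidualThetaLayer.PlusDual

end
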